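import Summits.Ventures.Crystal3D.StickySpheres.FccOctahedra
import Summits.Ventures.Crystal3D.StickySpheres.FccAllN
import Summits.Ventures.Crystal3D.LocalLP.ClassicalInputsDischarged
import HarnessLib

/-!
# The surface term `6N − C(N)` is of exact order `N^{2/3}`: brackets toward Bezdek's Problem 2

HONEST FRAMING. Part of the venture `Summits/Ventures/Crystal3D` (cell `pub-crystal3d`, seat p3).
COMPOSITION ONLY of three theorems already in the tree, all at the standard axioms — no new
mathematics, no census / certificate content, no crystallization statement:

* the Lévy rung `maxContacts_lt_levy` — `C(N) < 6N − 1.67·N^{2/3}` for `N ≥ 2`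
  (`LocalLP/ClassicalInputsDischarged.lean`; Lévy–Schmidt and Federer are tree theorems);
* the all-`N` staircase bound `six_mul_sub_ten_mul_rpow_le_maxContacts` — `6N − 10·N^{2/3} ≤ C(N)`
  (`StickySpheres/FccAllN.lean`);
* Bezdek 2012 (DCG 48) Thm 1.1 (iii) `octahedralLowerBound_holds` — `6n − ∛486·n^{2/3} < C(n)` along
  `n = k(2k²+1)/3`, `k ≥ 2` (`StickySpheres/FccOctahedra.lean`).

What they give together, stated once so that the paper's sentence on Bezdek's Problem 2
("does `lim (6n − C(n))/n^{2/3}` exist?", Fields Inst. Commun. 69 (2013) §2.1; the venture Prop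
`SurfaceConstantExists`, OPEN) has a formal referent:

* `surfaceTerm_bracket` — `1.67·N^{2/3} < 6N − C(N) ≤ 10·N^{2/3}` for every `N ≥ 2`, i.e.
  `6N − C(N) = Θ(N^{2/3})`; normalised: `(6N − C(N))/N^{2/3} ∈ (1.67, 10]` (`surfaceRatio_mem_Ioc`);
* `surfaceTerm_bracket_octahedral` — `1.67·n^{2/3} < 6n − C(n) < ∛486·n^{2/3}` along the octahedral
  numbers (`∛486 = 7.8622…`);
* `surfaceConstant_mem_Icc` — IF the limit `κ` exists then `1.67 ≤ κ ≤ ∛486`; equivalently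
  `SurfaceConstantExists ↔ ∃ κ ∈ [167/100, 486^{1/3}], (6N − C(N))/N^{2/3} → κ`
  (`surfaceConstantExists_iff_exists_mem_Icc`).

The existence of the limit is NOT claimed (OPEN); `Statement.lean` is not touched (its docstring's
«Known: 0.926 < … < 7.862… along n = k(2k²+1)/3» is hereby sharpened in the tree to `1.67` below for
all `N` and `10` above for all `N`).
-/

noncomputable section

open scoped Topology
open Filter

namespace Summit.Ventures.Crystal3D

/-! ## Pointwise brackets -/

/-- **The surface term is of exact order `N^{2/3}`**: `1.67·N^{2/3} < 6N − C(N) ≤ 10·N^{2/3}` for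
every `N ≥ 2` (Lévy rung `maxContacts_lt_levy`; all-`N` staircase bound
`six_mul_sub_ten_mul_rpow_le_maxContacts`). [folklore] -/
theorem surfaceTerm_bracket {N : ℕ} (hN : 2 ≤ N) :
    167 / 100 * (N : ℝ) ^ ((2 : ℝ) / 3) < 6 * (N : ℝ) - maxContacts 3 N ∧
      6 * (N : ℝ) - maxContacts 3 N ≤ 10 * (N : ℝ) ^ ((2 : ℝ) / 3) := by
  have h1 := maxContacts_lt_levy hN
  have h2 := six_mul_sub_ten_mul_rpow_le_maxContacts N
  constructor <;> linarith

/-- `k ≤ k(2k²+1)/3`: the octahedral numbers dominate their index. [folklore] -/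
theorem self_le_octahedralNumber (k : ℕ) : k ≤ octahedralNumber k := by
  rcases Nat.eq_zero_or_pos k with rfl | hk
  · simp [octahedralNumber]
  · rw [octahedralNumber, Nat.le_div_iff_mul_le (by norm_num : 0 < 3)]
    exact Nat.mul_le_mul_left k (by nlinarith)

/-- The octahedral numbers tend to infinity. [folklore] -/
theorem tendsto_octahedralNumber_atTop : Tendsto octahedralNumber atTop atTop :=
  tendsto_atTop_mono self_le_octahedralNumber tendsto_id

/-- **Along the octahedral numbers** `n = k(2k²+1)/3`, `k ≥ 2`:
`1.67·n^{2/3} < 6n − C(n) < ∛486·n^{2/3}` (Lévy rung; Bezdek 2012 Thm 1.1 (iii) =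
`octahedralLowerBound_holds`). [folklore] -/
theorem surfaceTerm_bracket_octahedral {k : ℕ} (hk : 2 ≤ k) :
    167 / 100 * (octahedralNumber k : ℝ) ^ ((2 : ℝ) / 3) <
        6 * (octahedralNumber k : ℝ) - maxContacts 3 (octahedralNumber k) ∧
      6 * (octahedralNumber k : ℝ) - maxContacts 3 (octahedralNumber k) <
        (486 : ℝ) ^ ((1 : ℝ) / 3) * (octahedralNumber k : ℝ) ^ ((2 : ℝ) / 3) := by
  have h1 := maxContacts_lt_levy (hk.trans (self_le_octahedralNumber k))
  have h2 := octahedralLowerBound_holds k hk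
  constructor <;> linarith

/-! ## The normalised surface term `(6N − C(N))/N^{2/3}` -/

/-- `1.67 < (6N − C(N))/N^{2/3}` for `N ≥ 2`. [folklore] -/
theorem levy_lt_surfaceRatio {N : ℕ} (hN : 2 ≤ N) :
    (167 / 100 : ℝ) < (6 * (N : ℝ) - maxContacts 3 N) / (N : ℝ) ^ ((2 : ℝ) / 3) := by
  have hpos : (0 : ℝ) < (N : ℝ) ^ ((2 : ℝ) / 3) :=
    Real.rpow_pos_of_pos (by exact_mod_cast (show 0 < N by omega)) _
  rw [lt_div_iff₀ hpos]
  exact (surfaceTerm_bracket hN).1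

/-- `(6N − C(N))/N^{2/3} ≤ 10` for every `N` (at `N = 0` the quotient is `0/0 = 0`). [folklore] -/
theorem surfaceRatio_le_ten (N : ℕ) :
    (6 * (N : ℝ) - maxContacts 3 N) / (N : ℝ) ^ ((2 : ℝ) / 3) ≤ 10 := by
  have h2 := six_mul_sub_ten_mul_rpow_le_maxContacts N
  have hnn : (0 : ℝ) ≤ (N : ℝ) ^ ((2 : ℝ) / 3) := Real.rpow_nonneg (Nat.cast_nonneg N) _
  rcases hnn.eq_or_lt with h0 | hpos
  · rw [← h0, div_zero]; norm_num
  · rw [div_le_iff₀ hpos]; linarith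

/-- The normalised surface term lies in `(1.67, 10]` for every `N ≥ 2`; in particular the sequence is
bounded above and below — the unconditional content toward Problem 2 (`6N − C(N) = Θ(N^{2/3})`).
[folklore] -/
theorem surfaceRatio_mem_Ioc {N : ℕ} (hN : 2 ≤ N) :
    (6 * (N : ℝ) - maxContacts 3 N) / (N : ℝ) ^ ((2 : ℝ) / 3) ∈ Set.Ioc (167 / 100 : ℝ) 10 :=
  ⟨levy_lt_surfaceRatio hN, surfaceRatio_le_ten N⟩

/-- `(6n − C(n))/n^{2/3} < ∛486` along `n = k(2k²+1)/3`, `k ≥ 2`. [folklore] -/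
theorem surfaceRatio_octahedral_lt {k : ℕ} (hk : 2 ≤ k) :
    (6 * (octahedralNumber k : ℝ) - maxContacts 3 (octahedralNumber k)) /
        (octahedralNumber k : ℝ) ^ ((2 : ℝ) / 3) < (486 : ℝ) ^ ((1 : ℝ) / 3) := by
  have hn : 0 < octahedralNumber k := by
    have := self_le_octahedralNumber k; omega
  have hpos : (0 : ℝ) < (octahedralNumber k : ℝ) ^ ((2 : ℝ) / 3) :=
    Real.rpow_pos_of_pos (by exact_mod_cast hn) _
  rw [div_lt_iff₀ hpos]
  exact (surfaceTerm_bracket_octahedral hk).2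

/-! ## Toward Bezdek's Problem 2: where the surface constant can lie -/

/-- **If Bezdek's surface constant exists, it lies in `[1.67, ∛486]`** (`∛486 = 7.8622…`): any limit
`κ` of `(6N − C(N))/N^{2/3}` satisfies `167/100 ≤ κ ≤ 486^{1/3}` — the lower bound from the Lévy rung
at every `N ≥ 2`, the upper bound along the octahedral subsequence (Bezdek 2012 Thm 1.1 (iii)). The
existence of the limit (`SurfaceConstantExists`, Bezdek 2013 Problem 2) is OPEN and NOT claimed.
[folklore] -/
theorem surfaceConstant_mem_Icc {κ : ℝ}
    (h : Tendsto (fun N : ℕ => (6 * (N : ℝ) - maxContacts 3 N) / (N : ℝ) ^ ((2 : ℝ) / 3))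
      atTop (𝓝 κ)) :
    167 / 100 ≤ κ ∧ κ ≤ (486 : ℝ) ^ ((1 : ℝ) / 3) := by
  refine ⟨ge_of_tendsto h (eventually_atTop.2 ⟨2, fun N hN => (levy_lt_surfaceRatio hN).le⟩), ?_⟩
  exact le_of_tendsto (h.comp tendsto_octahedralNumber_atTop)
    (eventually_atTop.2 ⟨2, fun k hk => (surfaceRatio_octahedral_lt hk).le⟩)

/-- **Problem 2, bracketed form**: `SurfaceConstantExists` holds iff the normalised surface term
converges to some `κ ∈ [1.67, ∛486]` (an equivalence of statements; neither side is claimed).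
[folklore] -/
theorem surfaceConstantExists_iff_exists_mem_Icc :
    SurfaceConstantExists ↔
      ∃ κ ∈ Set.Icc (167 / 100 : ℝ) ((486 : ℝ) ^ ((1 : ℝ) / 3)),
        Tendsto (fun N : ℕ => (6 * (N : ℝ) - maxContacts 3 N) / (N : ℝ) ^ ((2 : ℝ) / 3))
          atTop (𝓝 κ) := by
  constructor
  · rintro ⟨κ, hκ⟩
    exact ⟨κ, surfaceConstant_mem_Icc hκ, hκ⟩
  · rintro ⟨κ, -, hκ⟩
    exact ⟨κ, hκ⟩

end Summit.Ventures.Crystal3D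

end
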